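import Summits.AtomisticToContinuum.HydrodynamicLimit.Theorems.CollisionIsometryCLTMacroClosureTwoScaleDefs
import Summits.AtomisticToContinuum.HydrodynamicLimit.Theorems.CollisionIsometryCLTMacroClosureTwoScaleAdmissible
import Summits.AtomisticToContinuum.HydrodynamicLimit.Theorems.CollisionIsometryCLTMacroClosureCellRate
import Summits.AtomisticToContinuum.HydrodynamicLimit.Theorems.CollisionIsometryCLTMacroClosureThermoLimit
import Literature.MathematicalPhysics.KineticTheory.HardSphereEulerProofs
import Literature.InformationTheory.Entropy.MultinomialBound
import Summits.AtomisticToContinuum.HydrodynamicLimit.Theses.StiffCollisionalRelaxation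
import HarnessLib

/-!
# Asymptotics of the occupation-pattern weights (input of `stub_blockMGF_twoScale`,
line `IdeatorTwoGen1Sketch`, crux `MacroClosure`, stmt-AtomisticToContinuum-14870)

Proof file (`--supports stmt-AtomisticToContinuum-14870`) for the registered stub `Barycentric.stub_twoScale_patternAsymptotics`.

* Conjunct 1 (`PatternAsymptotics.pattern_upper`): the MULTINOMIAL BOUND `S!/∏ nₖ! ≤ exp(−Σ nₖ log(nₖ/S))`
  (`PatternAsymptotics.multinomial_le_exp`, the entropy form of the tree's
  `Literature.InformationTheory.Entropy.factorial_sum_mul_prod_pow_le`), the landed uniform CELL RATE `stub_cellRate` on `[min(aσ³, c), c]`,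
  `c = (1+1/64)³ < 11/10`, applied in every cell simultaneously (the separation `(η_κ/n_κ)^{1/3}` is
  `hsDiameter σ N / ℓ_N`, and `n_κ ≥ a(N+1)ℓ_N³ → ∞`, `PatternAsymptotics.tendsto_cellMass`), and bookkeeping of
  the exponents (`log(n/((N+1)ℓ³)) = log(n/(N+1)) − 3 log ℓ`).
* Conjunct 2 (`PatternAsymptotics.partition_lower`): `vol(posDomain) = hsFreeVolume σ³ (N+1) > 0`
  (`EosCesaro.hsFreeVolume_eq_toReal`, `volume_setOf_lt_euclidDist_pos`) and the landed thermodynamic limit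
  `hs_thermoLimit`.
-/

noncomputable section

open MeasureTheory Filter Set Topology InformationTheory
open scoped ENNReal ContDiff Convolution

namespace Summit.AtomisticToContinuum.HydrodynamicLimit.Theorems.MacroClosureLine

open Literature.MathematicalPhysics.KineticTheory Literature.Analysis.FluidPDE
open Literature.Analysis.FunctionSpaces
open Summit.AtomisticToContinuum.HydrodynamicLimit.Theses

namespace Barycentric

namespace PatternAsymptotics

/-- The entropy form of one factor: `exp(−n log(n/S)) = Sⁿ/nⁿ` (`n ≤ S`; both sides are `1` at `n = 0`). -/
theorem exp_neg_mul_log_div {n S : ℕ} (h : n ≤ S) :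
    Real.exp (-((n : ℝ) * Real.log ((n : ℝ) / (S : ℝ)))) = (S : ℝ) ^ n / (n : ℝ) ^ n := by
  rcases Nat.eq_zero_or_pos n with hn | hn
  · subst hn; simp
  · have hS : 0 < S := lt_of_lt_of_le hn h
    have hn' : (0 : ℝ) < n := by exact_mod_cast hn
    have hS' : (0 : ℝ) < S := by exact_mod_cast hS
    rw [Real.log_div hn'.ne' hS'.ne', show -((n : ℝ) * (Real.log n - Real.log S)) =
      (n : ℝ) * Real.log S - (n : ℝ) * Real.log n by ring, Real.exp_sub, Real.exp_nat_mul,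
      Real.exp_nat_mul, Real.exp_log hn', Real.exp_log hS']

/-- **Multinomial bound, entropy form**: `S!/∏ nₖ! ≤ exp(−Σ nₖ log(nₖ/S))` for `Σ nₖ = S`
(from `Literature.InformationTheory.Entropy.factorial_sum_mul_prod_pow_le`: `S! ∏ nₖ^{nₖ} ≤ S^S ∏ nₖ!`). -/
theorem multinomial_le_exp {K : Type*} [Fintype K] (n : K → ℕ) {S : ℕ} (hS : ∑ κ, n κ = S) :
    (S.factorial : ℝ) / ∏ κ, ((n κ).factorial : ℝ) ≤
      Real.exp (-(∑ κ, (n κ : ℝ) * Real.log ((n κ : ℝ) / (S : ℝ)))) := by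
  classical
  have hle : ∀ κ, n κ ≤ S := fun κ => hS ▸ Finset.single_le_sum (fun i _ => Nat.zero_le (n i)) (Finset.mem_univ κ)
  have hpow : ∀ κ, (0 : ℝ) < (n κ : ℝ) ^ n κ := fun κ => by
    rcases Nat.eq_zero_or_pos (n κ) with h | h
    · rw [h, pow_zero]; exact one_pos
    · exact pow_pos (by exact_mod_cast h) _
  rw [← Finset.sum_neg_distrib, Real.exp_sum, Finset.prod_congr rfl (fun κ _ => exp_neg_mul_log_div (hle κ)),
    Finset.prod_div_distrib, Finset.prod_pow_eq_pow_sum, hS,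
    div_le_div_iff₀ (Finset.prod_pos fun κ _ => by positivity) (Finset.prod_pos fun κ _ => hpow κ)]
  have := Literature.InformationTheory.Entropy.factorial_sum_mul_prod_pow_le Finset.univ n
  rw [hS] at this
  exact_mod_cast this

/-- The expected cell occupation at unit density diverges: `(N+1) ℓ_N³ ≥ (N+1)^{4/5}/128³ → ∞`. -/
theorem tendsto_cellMass : Tendsto (fun N : ℕ => ((N : ℝ) + 1) * side N ^ 3) atTop atTop := by
  have hlow : ∀ N : ℕ, ((N : ℝ) + 1) ^ (4 / 5 : ℝ) / 128 ^ 3 ≤ ((N : ℝ) + 1) * side N ^ 3 := by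
    intro N
    have hx : (0 : ℝ) < (N : ℝ) + 1 := by positivity
    have h3 : (((N : ℝ) + 1) ^ (-(1 / 15 : ℝ)) / 128) ^ 3 ≤ side N ^ 3 :=
      pow_le_pow_left₀ (by positivity) (TwoScaleAdmissible.le_side N) 3
    have hid : ((N : ℝ) + 1) ^ (4 / 5 : ℝ) / 128 ^ 3 =
        ((N : ℝ) + 1) * (((N : ℝ) + 1) ^ (-(1 / 15 : ℝ)) / 128) ^ 3 := by
      rw [div_pow, ← Real.rpow_mul_natCast hx.le, show (4 / 5 : ℝ) = 1 + -(1 / 15 : ℝ) * ((3 : ℕ) : ℝ) by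
        norm_num, Real.rpow_add hx, Real.rpow_one]
      ring
    rw [hid]
    exact mul_le_mul_of_nonneg_left h3 hx.le
  refine tendsto_atTop_mono hlow ?_
  refine Tendsto.atTop_div_const (by norm_num) ?_
  exact (tendsto_rpow_atTop (by norm_num)).comp
    (tendsto_atTop_add_const_right _ _ tendsto_natCast_atTop_atTop)

/-- `hsDiameter σ N = (σ³/(N+1))^{1/3}`. -/
theorem rpow_third_eq_hsDiameter {σ : ℝ} (hσ : 0 ≤ σ) (N : ℕ) :
    (σ ^ 3 / ((N + 1 : ℕ) : ℝ)) ^ (1 / 3 : ℝ) = hsDiameter σ N := by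
  -- adapted from HardSphereLDA.posPartition_one_eq_hsFreeVolume
  have hN : (0 : ℝ) ≤ ((N + 1 : ℕ) : ℝ) := by positivity
  rw [hsDiameter, Real.div_rpow (pow_nonneg hσ 3) hN, Real.rpow_neg hN, div_eq_mul_inv]
  congr 1
  rw [show ((1 : ℝ) / 3) = ((3 : ℕ) : ℝ)⁻¹ by norm_num]
  exact Real.pow_rpow_inv_natCast hσ (by norm_num)

/-- The free volume at reduced density `σ³` is the Haar measure of the non-overlap set at diameter `hsDiameter σ N`. -/
theorem hsFreeVolume_eq_volume_posDomain {σ : ℝ} (hσ : 0 ≤ σ) (N : ℕ) :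
    hsFreeVolume (σ ^ 3) (N + 1) = (volume (posDomain (hsDiameter σ N) (N + 1))).toReal := by
  rw [EosCesaro.hsFreeVolume_eq_toReal, rpow_third_eq_hsDiameter hσ N]

/-- Positivity of the free volume at reduced density `σ³`, `σ ≤ 1/2`. -/
theorem hsFreeVolume_pos {σ : ℝ} (hσ : 0 ≤ σ) (hσ2 : σ ≤ 1 / 2) (N : ℕ) :
    0 < hsFreeVolume (σ ^ 3) (N + 1) := by
  rw [hsFreeVolume, rpow_third_eq_hsDiameter hσ N]
  exact ENNReal.toReal_pos (volume_setOf_lt_euclidDist_pos hσ2 N).ne' (measure_ne_top _ _)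

/-- **Conjunct 2**: the partition-function lower bound from the thermodynamic limit. -/
theorem partition_lower {σ ε' : ℝ} (hσ : 0 < σ) (hσ2 : σ ≤ 1 / 2) (hε' : 0 < ε') :
    ∀ᶠ N : ℕ in atTop, Real.exp (-(((N : ℝ) + 1) * (hsExcessFreeEnergy (σ ^ 3) + ε'))) ≤
      (volume (posDomain (hsDiameter σ N) (N + 1))).toReal := by
  have hη : 0 < σ ^ 3 := by positivity
  have hη1 : σ ^ 3 < 11 / 10 :=
    lt_of_le_of_lt (pow_le_pow_left₀ hσ.le hσ2 3) (by norm_num)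
  have hT := (hs_thermoLimit (σ ^ 3) hη hη1).comp (tendsto_add_atTop_nat 1)
  filter_upwards [hT.eventually_lt_const (lt_add_of_pos_right _ hε')] with N hN
  rw [Function.comp_apply] at hN
  push_cast at hN
  have hV := hsFreeVolume_pos hσ.le hσ2 N
  have hN1 : (0 : ℝ) < (N : ℝ) + 1 := by positivity
  have key : ((N : ℝ) + 1) * (-((N : ℝ) + 1)⁻¹ * Real.log (hsFreeVolume (σ ^ 3) (N + 1))) =
      -Real.log (hsFreeVolume (σ ^ 3) (N + 1)) := by field_simp
  have h1 := mul_lt_mul_of_pos_left hN hN1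
  rw [key] at h1
  rw [← hsFreeVolume_eq_volume_posDomain hσ.le N]
  calc Real.exp (-(((N : ℝ) + 1) * (hsExcessFreeEnergy (σ ^ 3) + ε')))
      ≤ Real.exp (Real.log (hsFreeVolume (σ ^ 3) (N + 1))) := Real.exp_le_exp.2 (by linarith)
    _ = hsFreeVolume (σ ^ 3) (N + 1) := Real.exp_log hV

/-- **Conjunct 1**: the pattern-weight upper bound (multinomial bound × uniform cell rate). -/
theorem pattern_upper {σ a ε' : ℝ} (hσ : 0 < σ) (ha : 0 < a) (hε' : 0 < ε') :
    ∀ᶠ N : ℕ in atTop, ∀ n : (Fin 3 → Fin (mesh N)) → ℕ,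
      (∀ κ, a * (((N : ℝ) + 1) * side N ^ 3) ≤ n κ) →
      (∀ κ, (n κ : ℝ) * σ ^ 3 ≤ (1 + 1 / 64) ^ 3 * (((N : ℝ) + 1) * side N ^ 3)) →
      ∑ κ, n κ = N + 1 →
      ((N + 1).factorial : ℝ) / (∏ κ, ((n κ).factorial : ℝ)) *
        ∏ κ : Fin 3 → Fin (mesh N), (side N ^ (3 * n κ) *
          (volume {w : Fin (n κ) → V3 | (∀ i l, 0 ≤ w i l ∧ w i l ≤ 1) ∧
            ∀ i j, i ≠ j → hsDiameter σ N / side N ≤ ‖w i - w j‖}).toReal) ≤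
      Real.exp (-(∑ κ : Fin 3 → Fin (mesh N), ((n κ : ℝ) * Real.log ((n κ : ℝ) / (((N : ℝ) + 1) * side N ^ 3)) +
        (n κ : ℝ) * hsExcessFreeEnergy ((n κ : ℝ) * σ ^ 3 / (((N : ℝ) + 1) * side N ^ 3)))) + ε' * ((N : ℝ) + 1)) := by
  -- the uniform cell rate on `[a', c]`, `c = (1 + 1/64)³ < 11/10`, with `ε'/2`
  set c : ℝ := (1 + 1 / 64) ^ 3 with hc
  have hc11 : c < 11 / 10 := by norm_num [hc]
  have ha' : 0 < min (a * σ ^ 3) c := lt_min (by positivity) (by norm_num [hc])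
  obtain ⟨m₀, hm₀⟩ := Filter.eventually_atTop.1
    (stub_cellRate (min (a * σ ^ 3) c) c (ε' / 2) ha' (min_le_right _ _) hc11 (half_pos hε'))
  -- every cell eventually holds at least `m₀` particles
  filter_upwards [((tendsto_cellMass).const_mul_atTop ha).eventually_ge_atTop (m₀ : ℝ)] with N hN n hlow hup hsum
  have hℓ : 0 < side N := TwoScaleAdmissible.side_pos N
  set L : ℝ := ((N : ℝ) + 1) * side N ^ 3 with hL
  have hL0 : 0 < L := by positivity
  have hn0 : ∀ κ, 0 < n κ := fun κ => by
    have : (0 : ℝ) < n κ := lt_of_lt_of_le (by positivity) (hlow κ)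
    exact_mod_cast this
  have hnm : ∀ κ, m₀ ≤ n κ := fun κ => by exact_mod_cast hN.trans (hlow κ)
  -- packing fractions `η_κ = n_κ σ³ / L ∈ [a', c]`
  have hη1 : ∀ κ, min (a * σ ^ 3) c ≤ (n κ : ℝ) * σ ^ 3 / L := fun κ => by
    refine (min_le_left _ _).trans ?_
    rw [le_div_iff₀ hL0]
    nlinarith [hlow κ, pow_pos hσ 3]
  have hη2 : ∀ κ, (n κ : ℝ) * σ ^ 3 / L ≤ c := fun κ => by
    rw [div_le_iff₀ hL0]; exact hup κ
  -- the separation `(η_κ/n_κ)^{1/3} = hsDiameter σ N / ℓ`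
  set D : ℝ := hsDiameter σ N / side N with hD
  have hDpos : 0 < D := by
    rw [hD, hsDiameter]; exact div_pos (mul_pos hσ (Real.rpow_pos_of_pos (by positivity) _)) hℓ
  have hD3 : D ^ 3 = σ ^ 3 / L := by
    rw [hD, hL, hsDiameter, div_pow, mul_pow, ← Real.rpow_mul_natCast (by positivity),
      show (-(1 / 3 : ℝ)) * ((3 : ℕ) : ℝ) = -1 by norm_num, Real.rpow_neg_one]
    push_cast
    field_simp
  have hthr : ∀ κ, ((n κ : ℝ) * σ ^ 3 / L / (n κ : ℕ)) ^ (1 / 3 : ℝ) = D := fun κ => by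
    have hn : (n κ : ℝ) ≠ 0 := by exact_mod_cast (hn0 κ).ne'
    have h3 : (n κ : ℝ) * σ ^ 3 / L / (n κ : ℕ) = D ^ 3 := by rw [hD3]; field_simp
    rw [h3, show (1 / 3 : ℝ) = ((3 : ℕ) : ℝ)⁻¹ by norm_num, Real.pow_rpow_inv_natCast hDpos.le (by norm_num)]
  -- per-cell volume bound
  have hcell : ∀ κ, (volume {w : Fin (n κ) → V3 | (∀ i l, 0 ≤ w i l ∧ w i l ≤ 1) ∧
      ∀ i j, i ≠ j → D ≤ ‖w i - w j‖}).toReal ≤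
      Real.exp (-((n κ : ℝ) * (hsExcessFreeEnergy ((n κ : ℝ) * σ ^ 3 / L) - ε' / 2))) := fun κ => by
    have h := hm₀ (n κ) (hnm κ) _ (hη1 κ) (hη2 κ)
    rw [hthr κ] at h
    exact h
  have hprod : ∏ κ, (side N ^ (3 * n κ) * (volume {w : Fin (n κ) → V3 | (∀ i l, 0 ≤ w i l ∧ w i l ≤ 1) ∧
      ∀ i j, i ≠ j → D ≤ ‖w i - w j‖}).toReal) ≤
      ∏ κ, Real.exp (((3 * n κ : ℕ) : ℝ) * Real.log (side N) +
        -((n κ : ℝ) * (hsExcessFreeEnergy ((n κ : ℝ) * σ ^ 3 / L) - ε' / 2))) := by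
    refine Finset.prod_le_prod (fun κ _ => by positivity) (fun κ _ => ?_)
    rw [Real.exp_add, Real.exp_nat_mul, Real.exp_log hℓ]
    exact mul_le_mul_of_nonneg_left (hcell κ) (by positivity)
  rw [← Real.exp_sum] at hprod
  -- the multinomial bound
  have hmult := multinomial_le_exp n hsum
  push_cast at hmult
  -- assembly
  refine (mul_le_mul hmult hprod (Finset.prod_nonneg fun κ _ => by positivity) (Real.exp_nonneg _)).trans ?_
  rw [← Real.exp_add, Real.exp_le_exp]
  -- the exponents
  have hS : ∑ κ, (n κ : ℝ) = (N : ℝ) + 1 := by exact_mod_cast hsum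
  have hlog : ∀ κ, Real.log ((n κ : ℝ) / L) = Real.log ((n κ : ℝ) / ((N : ℝ) + 1)) - 3 * Real.log (side N) := by
    intro κ
    have hn : (n κ : ℝ) ≠ 0 := by exact_mod_cast (hn0 κ).ne'
    rw [Real.log_div hn hL0.ne', hL, Real.log_mul (by positivity) (by positivity), Real.log_pow,
      Real.log_div hn (by positivity)]
    push_cast
    ring
  have key : ∀ κ, -((n κ : ℝ) * Real.log ((n κ : ℝ) / L) +
      (n κ : ℝ) * hsExcessFreeEnergy ((n κ : ℝ) * σ ^ 3 / L)) =
      -((n κ : ℝ) * Real.log ((n κ : ℝ) / ((N : ℝ) + 1))) +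
        (((3 * n κ : ℕ) : ℝ) * Real.log (side N) +
          -((n κ : ℝ) * (hsExcessFreeEnergy ((n κ : ℝ) * σ ^ 3 / L) - ε' / 2))) - ε' / 2 * (n κ : ℝ) := by
    intro κ; rw [hlog κ]; push_cast; ring
  have hE : -(∑ κ, ((n κ : ℝ) * Real.log ((n κ : ℝ) / L) +
      (n κ : ℝ) * hsExcessFreeEnergy ((n κ : ℝ) * σ ^ 3 / L))) =
      -(∑ κ, (n κ : ℝ) * Real.log ((n κ : ℝ) / ((N : ℝ) + 1))) +
        ∑ κ, (((3 * n κ : ℕ) : ℝ) * Real.log (side N) +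
          -((n κ : ℝ) * (hsExcessFreeEnergy ((n κ : ℝ) * σ ^ 3 / L) - ε' / 2))) - ε' / 2 * ((N : ℝ) + 1) := by
    rw [← Finset.sum_neg_distrib, Finset.sum_congr rfl (fun κ _ => key κ), Finset.sum_sub_distrib,
      Finset.sum_add_distrib, ← Finset.sum_neg_distrib, ← Finset.mul_sum, hS]
  rw [hE]
  have : (0 : ℝ) ≤ ε' * ((N : ℝ) + 1) := by positivity
  linarith

end PatternAsymptotics

/-- **Asymptotics of the pattern weights and of the partition function** (registered stub `stub_twoScale_patternAsymptotics`). [cite: Ruelle1969, §3.4] -/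
theorem stub_twoScale_patternAsymptotics : StiffCollisionalRelaxation.HsFreeEnergyConvex → ∀ (σ a ε' : ℝ), 0 < σ →
    σ ≤ 1 / 2 → 0 < a → 0 < ε' →
    (∀ᶠ N : ℕ in atTop, ∀ n : (Fin 3 → Fin (mesh N)) → ℕ,
      (∀ κ, a * (((N : ℝ) + 1) * side N ^ 3) ≤ n κ) →
      (∀ κ, (n κ : ℝ) * σ ^ 3 ≤ (1 + 1 / 64) ^ 3 * (((N : ℝ) + 1) * side N ^ 3)) →
      ∑ κ, n κ = N + 1 →
      ((N + 1).factorial : ℝ) / (∏ κ, ((n κ).factorial : ℝ)) *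
        ∏ κ : Fin 3 → Fin (mesh N), (side N ^ (3 * n κ) *
          (volume {w : Fin (n κ) → V3 | (∀ i l, 0 ≤ w i l ∧ w i l ≤ 1) ∧
            ∀ i j, i ≠ j → hsDiameter σ N / side N ≤ ‖w i - w j‖}).toReal) ≤
      Real.exp (-(∑ κ : Fin 3 → Fin (mesh N), ((n κ : ℝ) * Real.log ((n κ : ℝ) / (((N : ℝ) + 1) * side N ^ 3)) +
        (n κ : ℝ) * hsExcessFreeEnergy ((n κ : ℝ) * σ ^ 3 / (((N : ℝ) + 1) * side N ^ 3)))) + ε' * ((N : ℝ) + 1))) ∧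
    (∀ᶠ N : ℕ in atTop, Real.exp (-(((N : ℝ) + 1) * (hsExcessFreeEnergy (σ ^ 3) + ε'))) ≤
      (volume (posDomain (hsDiameter σ N) (N + 1))).toReal) :=
  fun _ _ _ _ hσ hσ2 ha hε' =>
    ⟨PatternAsymptotics.pattern_upper hσ ha hε', PatternAsymptotics.partition_lower hσ hσ2 hε'⟩

end Barycentric

end Summit.AtomisticToContinuum.HydrodynamicLimit.Theorems.MacroClosureLine

end
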